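import Summits.Ventures.HodgeRepro2.T5SU11LegendreSeries

/-!
# The Fourier–Legendre coefficients of a `C²` function are absolutely summable

For `f` twice differentiable on `[−1, 1]` with continuous second derivative (`hf`, `hf'`, `hf''` below: `f' = f′`,
`f'' = f″` on `[−1, 1]`, `f″` continuous there) put `g := ((1 − x²) f′)′ = (1 − x²) f″ − 2x f′` (`sturm`). Two
integrations by parts against Legendre's equation in Sturm–Liouville form `((1 − x²) P′_k)′ = −k(k + 1) P_k`
(row 383) — the boundary terms vanish because `1 − x² = 0` at `±1` — give

  **`k(k + 1) ∫ f P_k = −∫ g P_k`**, i.e. **`c_k(f) = −c_k(g)/(k(k + 1))`** for `k ≥ 1`   (`fourierLegendre_eq_sturm`).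

Bessel's inequality for `g` (row 420) and the Cauchy–Schwarz inequality then bound the partial sums
`Σ_{k<d} |c_k(f)| ≤ |c_0(f)| + √2 · √(∫ g²)` (`sum_abs_fourierLegendre_le`, with `Σ_{k≥1} 1/k² ≤ 2`), so

  **`Σ_k |c_k(f)| < ∞`**   (`summable_abs_fourierLegendre`):

the Fourier–Legendre coefficients of a `C²` function are absolutely summable (the next file turns this into the
uniform convergence of the Legendre series). Nothing is claimed about (N).

Blind lane: Mathlib + the HodgeRepro2 prefix only; no sorry; axioms ⊆ {propext, Classical.choice,
Quot.sound}.
-/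

namespace Summit.Ventures.HodgeRepro2.T5SU11LegendreCoefficientDecay

open Polynomial intervalIntegral Finset Filter Topology MeasureTheory
open Set (Icc Ioc Ioo uIcc uIoc EqOn)
open T5SU11SphericalLegendreAll T5SU11LegendreIdentities T5SU11LegendreOrthogonal T5SU11LegendreSeries

/-! ### The Sturm–Liouville operator and the two integrations by parts -/

/-- **`g = ((1 − x²) f′)′ = (1 − x²) f″ − 2x f′`**, the Sturm–Liouville operator applied to `f`. -/
noncomputable def sturm (f' f'' : ℝ → ℝ) (x : ℝ) : ℝ := (1 - x ^ 2) * f'' x - 2 * x * f' x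

section C2

variable {f f' f'' : ℝ → ℝ}
  (hf : ∀ x ∈ Icc (-1 : ℝ) 1, HasDerivAt f (f' x) x)
  (hf' : ∀ x ∈ Icc (-1 : ℝ) 1, HasDerivAt f' (f'' x) x)
  (hf'' : ContinuousOn f'' (Icc (-1 : ℝ) 1))

omit hf' hf'' in
include hf in
/-- `f` is continuous on `[−1, 1]`. -/
theorem continuousOn_of_hasDerivAt : ContinuousOn f (Icc (-1 : ℝ) 1) :=
  fun x hx => (hf x hx).continuousAt.continuousWithinAt

omit hf hf'' in
include hf' in
/-- `f′` is continuous on `[−1, 1]`. -/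
theorem continuousOn_deriv_of_hasDerivAt : ContinuousOn f' (Icc (-1 : ℝ) 1) :=
  fun x hx => (hf' x hx).continuousAt.continuousWithinAt

omit hf in
include hf' hf'' in
/-- `g = (1 − x²) f″ − 2x f′` is continuous on `[−1, 1]`. -/
theorem continuousOn_sturm : ContinuousOn (sturm f' f'') (Icc (-1 : ℝ) 1) := by
  have h1 : ContinuousOn (fun x : ℝ => (1 - x ^ 2) * f'' x) (Icc (-1 : ℝ) 1) :=
    (continuous_const.sub (continuous_pow 2)).continuousOn.mul hf''
  have h2 : ContinuousOn (fun x : ℝ => 2 * x * f' x) (Icc (-1 : ℝ) 1) :=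
    (continuous_const.mul continuous_id).continuousOn.mul (continuousOn_deriv_of_hasDerivAt hf')
  exact h1.sub h2

omit hf hf'' in
include hf' in
/-- **`(1 − x²) f′` has derivative `g`** at every point of `[−1, 1]`. -/
theorem hasDerivAt_one_sub_sq_mul {x : ℝ} (hx : x ∈ Icc (-1 : ℝ) 1) :
    HasDerivAt (fun x => (1 - x ^ 2) * f' x) (sturm f' f'' x) x := by
  have h := ((hasDerivAt_const x (1 : ℝ)).sub (hasDerivAt_pow 2 x)).mul (hf' x hx)
  refine h.congr_deriv ?_
  simp only [sturm, Pi.sub_apply]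
  push_cast
  ring

omit hf'' in
include hf hf' in
/-- **The first integration by parts**: `k(k + 1) ∫ f P_k = ∫ (1 − x²) f′ P′_k` (the boundary term vanishes
because `1 − x² = 0` at `±1`). -/
theorem integral_mul_legP_eq_integral_deriv (k : ℕ) :
    (k : ℝ) * ((k : ℝ) + 1) * ∫ x in (-1 : ℝ)..1, f x * legP k x
      = ∫ x in (-1 : ℝ)..1, (1 - x ^ 2) * f' x * legQ k x := by
  have hu : ∀ x ∈ uIcc (-1 : ℝ) 1, HasDerivAt f (f' x) x := fun x hx =>
    hf x (by rwa [Set.uIcc_of_le (by norm_num)] at hx)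
  have hv : ∀ x ∈ uIcc (-1 : ℝ) 1,
      HasDerivAt (fun x => (1 - x ^ 2) * legQ k x) (-((k : ℝ) * (k + 1)) * legP k x) x :=
    fun x _ => hasDerivAt_one_sub_sq_mul_legQ k x
  have hu' : IntervalIntegrable f' volume (-1 : ℝ) 1 :=
    (continuousOn_deriv_of_hasDerivAt hf').intervalIntegrable_of_Icc (by norm_num)
  have hv' : IntervalIntegrable (fun x => -((k : ℝ) * (k + 1)) * legP k x) volume (-1 : ℝ) 1 :=
    ((continuous_legP k).const_mul _).intervalIntegrable _ _
  have h := integral_mul_deriv_eq_deriv_mul hu hv hu' hv'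
  simp only [one_pow, sub_self, zero_mul, mul_zero, zero_sub, even_two, Even.neg_pow] at h
  have e1 : ∫ x in (-1 : ℝ)..1, f x * (-((k : ℝ) * (k + 1)) * legP k x)
      = -((k : ℝ) * (k + 1)) * ∫ x in (-1 : ℝ)..1, f x * legP k x := by
    rw [← intervalIntegral.integral_const_mul]
    refine integral_congr fun x _ => ?_
    ring
  have e2 : ∫ x in (-1 : ℝ)..1, f' x * ((1 - x ^ 2) * legQ k x)
      = ∫ x in (-1 : ℝ)..1, (1 - x ^ 2) * f' x * legQ k x := by
    refine integral_congr fun x _ => ?_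
    ring
  rw [e1, e2] at h
  linear_combination -h

omit hf in
include hf' hf'' in
/-- **The second integration by parts**: `∫ (1 − x²) f′ P′_k = −∫ g P_k` (the boundary term vanishes because
`(1 − x²) f′ = 0` at `±1`). -/
theorem integral_deriv_eq_neg_integral_sturm (k : ℕ) :
    ∫ x in (-1 : ℝ)..1, (1 - x ^ 2) * f' x * legQ k x = -∫ x in (-1 : ℝ)..1, sturm f' f'' x * legP k x := by
  have hu : ∀ x ∈ uIcc (-1 : ℝ) 1, HasDerivAt (fun x => (1 - x ^ 2) * f' x) (sturm f' f'' x) x :=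
    fun x hx => hasDerivAt_one_sub_sq_mul hf' (by rwa [Set.uIcc_of_le (by norm_num)] at hx)
  have hv : ∀ x ∈ uIcc (-1 : ℝ) 1, HasDerivAt (legP k) (legQ k x) x := fun x _ => hasDerivAt_legP k x
  have hu' : IntervalIntegrable (sturm f' f'') volume (-1 : ℝ) 1 :=
    (continuousOn_sturm hf' hf'').intervalIntegrable_of_Icc (by norm_num)
  have hv' : IntervalIntegrable (legQ k) volume (-1 : ℝ) 1 := (continuous_legQ k).intervalIntegrable _ _
  have h := integral_mul_deriv_eq_deriv_mul hu hv hu' hv'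
  simp only [one_pow, sub_self, zero_mul, zero_sub, even_two, Even.neg_pow] at h
  have e : ∫ x in (-1 : ℝ)..1, (1 - x ^ 2) * f' x * legQ k x
      = ∫ x in (-1 : ℝ)..1, (fun x => (1 - x ^ 2) * f' x) x * legQ k x := by
    refine integral_congr fun x _ => ?_
    simp only
  rw [e, h]

include hf hf' hf'' in
/-- **`k(k + 1) ∫ f P_k = −∫ g P_k`** with `g = ((1 − x²) f′)′`. -/
theorem integral_mul_legP_eq_neg (k : ℕ) :
    (k : ℝ) * ((k : ℝ) + 1) * ∫ x in (-1 : ℝ)..1, f x * legP k x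
      = -∫ x in (-1 : ℝ)..1, sturm f' f'' x * legP k x := by
  rw [integral_mul_legP_eq_integral_deriv hf hf', integral_deriv_eq_neg_integral_sturm hf' hf'']

include hf hf' hf'' in
/-- **`c_k(f) = −c_k(g)/(k(k + 1))`** for `k ≥ 1`: the Fourier–Legendre coefficients of a `C²` function are those
of `g = ((1 − x²) f′)′` divided by `−k(k + 1)`. -/
theorem fourierLegendre_eq_sturm {k : ℕ} (hk : 1 ≤ k) :
    fourierLegendre f k = -fourierLegendre (sturm f' f'') k / ((k : ℝ) * ((k : ℝ) + 1)) := by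
  have hne : (k : ℝ) * ((k : ℝ) + 1) ≠ 0 := by
    have : (1 : ℝ) ≤ (k : ℝ) := by exact_mod_cast hk
    positivity
  have h := integral_mul_legP_eq_neg hf hf' hf'' k
  rw [eq_div_iff hne, fourierLegendre, fourierLegendre]
  linear_combination ((2 * (k : ℝ) + 1) / 2) * h

/-! ### Absolute summability of the coefficients -/

include hf hf' hf'' in
/-- **The partial sums of `|c_k(f)|` are bounded**: `Σ_{k<d} |c_k(f)| ≤ |c_0(f)| + √2 · √(∫ g²)` (Bessel for `g` +
Cauchy–Schwarz + `Σ_{k≥1} 1/k² ≤ 2`). -/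
theorem sum_abs_fourierLegendre_le (d : ℕ) :
    ∑ k ∈ range d, |fourierLegendre f k|
      ≤ |fourierLegendre f 0| + Real.sqrt 2 * Real.sqrt (∫ x in (-1 : ℝ)..1, sturm f' f'' x ^ 2) := by
  set g := sturm f' f'' with hg
  have hgc : ContinuousOn g (Icc (-1 : ℝ) 1) := continuousOn_sturm hf' hf''
  -- step 1: `range d ⊆ insert 0 (Finset.Ioo 0 d)`
  have h1 : ∑ k ∈ range d, |fourierLegendre f k| ≤ |fourierLegendre f 0| + ∑ k ∈ Finset.Ioo 0 d, |fourierLegendre f k| := by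
    have hsub : range d ⊆ insert 0 (Finset.Ioo 0 d) := by
      intro k hk
      rw [Finset.mem_insert, Finset.mem_Ioo]
      have := Finset.mem_range.mp hk
      omega
    have h0 : (0 : ℕ) ∉ Finset.Ioo 0 d := by simp
    calc ∑ k ∈ range d, |fourierLegendre f k| ≤ ∑ k ∈ insert 0 (Finset.Ioo 0 d), |fourierLegendre f k| :=
          Finset.sum_le_sum_of_subset_of_nonneg hsub fun k _ _ => abs_nonneg _
      _ = |fourierLegendre f 0| + ∑ k ∈ Finset.Ioo 0 d, |fourierLegendre f k| := Finset.sum_insert h0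
  -- step 2: on `Finset.Ioo 0 d`, `|c_k(f)| = u_k v_k` with `u_k = |c_k(g)| √(2/(2k+1))`, `v_k = √((2k+1)/2)/(k(k+1))`
  have h2 : ∀ k ∈ Finset.Ioo 0 d, |fourierLegendre f k|
      = (|fourierLegendre g k| * Real.sqrt (2 / (2 * (k : ℝ) + 1)))
        * (Real.sqrt ((2 * (k : ℝ) + 1) / 2) / ((k : ℝ) * ((k : ℝ) + 1))) := by
    intro k hk
    have hk1 : 1 ≤ k := Nat.succ_le_of_lt (Finset.mem_Ioo.mp hk).1
    have hkpos : (0 : ℝ) < (k : ℝ) * ((k : ℝ) + 1) := by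
      have : (1 : ℝ) ≤ (k : ℝ) := by exact_mod_cast hk1
      positivity
    rw [fourierLegendre_eq_sturm hf hf' hf'' hk1, abs_div, abs_neg, abs_of_pos hkpos]
    have hs : Real.sqrt (2 / (2 * (k : ℝ) + 1)) * Real.sqrt ((2 * (k : ℝ) + 1) / 2) = 1 := by
      rw [← Real.sqrt_mul (by positivity)]
      have : (2 / (2 * (k : ℝ) + 1)) * ((2 * (k : ℝ) + 1) / 2) = 1 := by
        field_simp
      rw [this, Real.sqrt_one]
    calc |fourierLegendre g k| / ((k : ℝ) * ((k : ℝ) + 1))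
        = |fourierLegendre g k| * (Real.sqrt (2 / (2 * (k : ℝ) + 1)) * Real.sqrt ((2 * (k : ℝ) + 1) / 2))
            / ((k : ℝ) * ((k : ℝ) + 1)) := by rw [hs, mul_one]
      _ = _ := by ring
  -- step 3: Cauchy–Schwarz
  have h3 : ∑ k ∈ Finset.Ioo 0 d, |fourierLegendre f k|
      ≤ Real.sqrt (∑ k ∈ Finset.Ioo 0 d, (|fourierLegendre g k| * Real.sqrt (2 / (2 * (k : ℝ) + 1))) ^ 2)
        * Real.sqrt (∑ k ∈ Finset.Ioo 0 d, (Real.sqrt ((2 * (k : ℝ) + 1) / 2) / ((k : ℝ) * ((k : ℝ) + 1))) ^ 2) := by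
    rw [Finset.sum_congr rfl h2]
    exact Real.sum_mul_le_sqrt_mul_sqrt _ _ _
  -- step 4: Bessel for `g`
  have h4 : ∑ k ∈ Finset.Ioo 0 d, (|fourierLegendre g k| * Real.sqrt (2 / (2 * (k : ℝ) + 1))) ^ 2
      ≤ ∫ x in (-1 : ℝ)..1, g x ^ 2 := by
    have e : ∀ k ∈ Finset.Ioo 0 d, (|fourierLegendre g k| * Real.sqrt (2 / (2 * (k : ℝ) + 1))) ^ 2
        = fourierLegendre g k ^ 2 * (2 / (2 * (k : ℝ) + 1)) := by
      intro k _
      rw [mul_pow, sq_abs, Real.sq_sqrt (by positivity)]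
    rw [Finset.sum_congr rfl e]
    calc ∑ k ∈ Finset.Ioo 0 d, fourierLegendre g k ^ 2 * (2 / (2 * (k : ℝ) + 1))
        ≤ ∑ k ∈ range (d + 1), fourierLegendre g k ^ 2 * (2 / (2 * (k : ℝ) + 1)) := by
          refine Finset.sum_le_sum_of_subset_of_nonneg ?_ fun k _ _ => by positivity
          intro k hk
          rw [Finset.mem_range]
          have := (Finset.mem_Ioo.mp hk).2
          omega
      _ ≤ ∫ x in (-1 : ℝ)..1, g x ^ 2 := bessel hgc d
  -- step 5: `Σ_{0<k<d} (2k+1)/(2k²(k+1)²) ≤ Σ_{0<k<d} 1/k² ≤ 2`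
  have h5 : ∑ k ∈ Finset.Ioo 0 d, (Real.sqrt ((2 * (k : ℝ) + 1) / 2) / ((k : ℝ) * ((k : ℝ) + 1))) ^ 2 ≤ 2 := by
    calc ∑ k ∈ Finset.Ioo 0 d, (Real.sqrt ((2 * (k : ℝ) + 1) / 2) / ((k : ℝ) * ((k : ℝ) + 1))) ^ 2
        ≤ ∑ k ∈ Finset.Ioo 0 d, ((k : ℝ) ^ 2)⁻¹ := by
          refine Finset.sum_le_sum fun k hk => ?_
          have hk1 : 1 ≤ k := Nat.succ_le_of_lt (Finset.mem_Ioo.mp hk).1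
          have hk' : (1 : ℝ) ≤ (k : ℝ) := by exact_mod_cast hk1
          rw [div_pow, Real.sq_sqrt (by positivity)]
          rw [div_le_iff₀ (by positivity), inv_mul_eq_div, le_div_iff₀ (by positivity)]
          nlinarith
      _ ≤ 2 / ((0 : ℕ) + 1) := sum_Ioo_inv_sq_le 0 d
      _ = 2 := by norm_num
  -- assemble
  have hB : 0 ≤ ∫ x in (-1 : ℝ)..1, g x ^ 2 := integral_nonneg (by norm_num) fun x _ => sq_nonneg _
  calc ∑ k ∈ range d, |fourierLegendre f k|
      ≤ |fourierLegendre f 0| + ∑ k ∈ Finset.Ioo 0 d, |fourierLegendre f k| := h1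
    _ ≤ |fourierLegendre f 0|
        + Real.sqrt (∑ k ∈ Finset.Ioo 0 d, (|fourierLegendre g k| * Real.sqrt (2 / (2 * (k : ℝ) + 1))) ^ 2)
          * Real.sqrt (∑ k ∈ Finset.Ioo 0 d, (Real.sqrt ((2 * (k : ℝ) + 1) / 2) / ((k : ℝ) * ((k : ℝ) + 1))) ^ 2) := by
        linarith
    _ ≤ |fourierLegendre f 0| + Real.sqrt (∫ x in (-1 : ℝ)..1, g x ^ 2) * Real.sqrt 2 := by
        gcongr
    _ = |fourierLegendre f 0| + Real.sqrt 2 * Real.sqrt (∫ x in (-1 : ℝ)..1, g x ^ 2) := by ring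

include hf hf' hf'' in
/-- **`Σ_k |c_k(f)| < ∞`**: the Fourier–Legendre coefficients of a `C²` function are absolutely summable. -/
theorem summable_abs_fourierLegendre : Summable (fun k => |fourierLegendre f k|) :=
  summable_of_sum_range_le (fun _ => abs_nonneg _) (sum_abs_fourierLegendre_le hf hf' hf'')

end C2

end Summit.Ventures.HodgeRepro2.T5SU11LegendreCoefficientDecay
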